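import Mathlib
import Summits.Ventures.PercRepro2.TypedResidualR

/-!
# Restriction of an instance to its support, and the SIZE-BOUNDED spine (blind cell PercRepro2,
p2 g3, 2026-08-25; the tool that lets a new reduction rule enter S1's calculus as a LAYER)

An instance `(ends, F, z, τ)` only sees its SUPPORT `support F z` = the typed edges and the
pinned-open edges: every other edge is pinned closed and inert. Restricting the edge type to the
support (`rEnds`, `rF`, `rConfig`, `rτ`; the extension `extend`) keeps the typed count of the crux
kernel (`typedCount_restrict`: the connections, hence the 7-coordinate state, are unchanged —
`conn_restrict`). Consequence, **the bounded spine** `typedCount_nonneg_of_residualR_card_le`: if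
row 2′TRI holds on the `ResidualR` instances with at most `N` typed edges (over every edge type),
it holds on every instance whose support has at most `N` edges — the landed spine
`typedCount_nonneg_of_residualR` applied on the support. A rule that rewrites an instance into
instances of SMALLER support can therefore be added to the calculus by an induction on the
support size (`TypedTwoTerminalSpine.lean`).
-/

namespace Summit.Ventures.PercRepro2

namespace CovForm

namespace TypedRed

namespace Restrict

open OneTyped

universe uV uE

section Defs

variable {V : Type uV} {E : Type uE} [DecidableEq E]

/-- The support of an instance: the typed edges and the pinned-open edges. -/
def support [Fintype E] (F : Finset E) (z : Config E) : Finset E :=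
  F ∪ Finset.univ.filter fun e => z e = true

/-- The incidence map restricted to `S`. -/
def rEnds (S : Finset E) (ends : E → Sym2 V) : S → Sym2 V := fun e => ends e.1

/-- A typed set restricted to `S`. -/
def rF (S : Finset E) (F : Finset E) : Finset S := Finset.univ.filter fun e => e.1 ∈ F

/-- A configuration restricted to `S`. -/
def rConfig (S : Finset E) (z : Config E) : Config S := fun e => z e.1

/-- A type map restricted to `S`. -/
def rτ (S : Finset E) (τ : E → ℕ) : S → ℕ := fun e => τ e.1

/-- A configuration on `S` extended by closed edges. -/
def extend (S : Finset E) (x : Config S) : Config E :=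
  fun e => if h : e ∈ S then x ⟨e, h⟩ else false

/-- Membership in the support. -/
lemma mem_support [Fintype E] {F : Finset E} {z : Config E} {e : E} :
    e ∈ support F z ↔ e ∈ F ∨ z e = true := by
  simp [support]

/-- Membership in the restricted typed set. -/
lemma mem_rF {S F : Finset E} {e : S} : e ∈ rF S F ↔ e.1 ∈ F := by
  simp [rF]

/-- The extension is closed off `S`. -/
lemma extend_of_not_mem {S : Finset E} (x : Config S) {e : E} (h : e ∉ S) :
    extend S x e = false := by
  simp [extend, h]

/-- The extension on `S`. -/
lemma extend_of_mem {S : Finset E} (x : Config S) {e : E} (h : e ∈ S) :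
    extend S x e = x ⟨e, h⟩ := by
  simp [extend, h]

/-- Restricting the extension gives the configuration back. -/
lemma rConfig_extend (S : Finset E) (x : Config S) : rConfig S (extend S x) = x := by
  funext e
  simp [rConfig, extend, e.2]

/-- Extending the restriction of a configuration closed off `S` gives it back. -/
lemma extend_rConfig {S : Finset E} {z : Config E} (hz : ∀ e, e ∉ S → z e = false) :
    extend S (rConfig S z) = z := by
  funext e
  by_cases h : e ∈ S
  · simp [extend, rConfig, h]
  · simp [extend, h, hz e h]

end Defs

/-! ## Connections and the state are unchanged -/

section Conn

variable {V : Type uV} {E : Type uE} [DecidableEq E]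

/-- Connections of a configuration closed off `S` are those of its restriction to `S`. -/
lemma conn_restrict (S : Finset E) (ends : E → Sym2 V) {ω : Config E}
    (hω : ∀ e, e ∉ S → ω e = false) (p q : V) :
    Conn ends ω p q ↔ Conn (rEnds S ends) (rConfig S ω) p q := by
  constructor
  · intro h
    refine mem_of_conn_of_closed (S := {v | Conn (rEnds S ends) (rConfig S ω) p v}) ?_
      (conn_refl _ _ _) h
    intro x hx y hxy
    rw [openGraph_adj] at hxy
    obtain ⟨_, e, he, hends⟩ := hxy
    have heS : e ∈ S := by
      by_contra heS
      rw [hω e heS] at he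
      exact Bool.noConfusion he
    exact conn_trans hx (conn_of_openAdj ⟨⟨e, heS⟩, he, hends⟩)
  · intro h
    refine mem_of_conn_of_closed (S := {v | Conn ends ω p v}) ?_ (conn_refl _ _ _) h
    intro x hx y hxy
    rw [openGraph_adj] at hxy
    obtain ⟨_, e, he, hends⟩ := hxy
    exact conn_trans hx (conn_of_openAdj ⟨e.1, he, hends⟩)

/-- The state of a configuration closed off `S` is the state of its restriction. -/
lemma st_restrict (S : Finset E) (ends : E → Sym2 V) (o a₁ a₂ a₃ b : V) {ω : Config E}
    (hω : ∀ e, e ∉ S → ω e = false) :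
    st ends o a₁ a₂ a₃ b ω = st (rEnds S ends) o a₁ a₂ a₃ b (rConfig S ω) := by
  have key := fun (p q : V) => conn_restrict S ends hω p q
  unfold st
  simp only [Prod.mk.injEq]
  exact ⟨decide_eq_decide.mpr (key _ _), decide_eq_decide.mpr (key _ _),
    decide_eq_decide.mpr (key _ _), decide_eq_decide.mpr (key _ _),
    decide_eq_decide.mpr (key _ _), decide_eq_decide.mpr (key _ _),
    decide_eq_decide.mpr (key _ _)⟩

variable [Fintype E] {R : Type*} [Field R]

omit [Fintype E] in
/-- The crux kernel at copies closed off `S` is the kernel of the restriction. -/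
lemma K3_restrict (S : Finset E) (ends : E → Sym2 V) (o a₁ a₂ a₃ b : V) {x y w : Config E}
    (hx : ∀ e, e ∉ S → x e = false) (hy : ∀ e, e ∉ S → y e = false)
    (hw : ∀ e, e ∉ S → w e = false) :
    (K3 ends o a₁ a₂ a₃ b x y w : R) =
      K3 (rEnds S ends) o a₁ a₂ a₃ b (rConfig S x) (rConfig S y) (rConfig S w) := by
  rw [K3_eq_KB, K3_eq_KB, st_restrict S ends o a₁ a₂ a₃ b hx, st_restrict S ends o a₁ a₂ a₃ b hy,
    st_restrict S ends o a₁ a₂ a₃ b hw]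

end Conn

/-! ## The typed count is unchanged -/

section Count

variable {V : Type uV} {E : Type uE} [Fintype E] [DecidableEq E] {R : Type*} [Field R]

/-- A sum over all configurations of a function vanishing on the configurations open somewhere off
`S` is the sum over the configurations on `S`, extended by closed edges. -/
lemma sum_config_restrict (S : Finset E) (f : Config E → R)
    (hf : ∀ x : Config E, (∃ e, e ∉ S ∧ x e = true) → f x = 0) :
    ∑ x, f x = ∑ x : Config S, f (extend S x) := by
  have hsub : ∑ x, f x = ∑ x ∈ Finset.univ.filter (fun x : Config E => ∀ e, e ∉ S → x e = false),
      f x := by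
    symm
    refine Finset.sum_subset (Finset.subset_univ _) fun x _ hx => hf x ?_
    have hnot : ¬ ∀ e, e ∉ S → x e = false := fun h =>
      hx (Finset.mem_filter.2 ⟨Finset.mem_univ _, h⟩)
    by_contra hcon
    apply hnot
    intro e he
    by_contra hne
    exact hcon ⟨e, he, by simpa using hne⟩
  rw [hsub]
  refine Finset.sum_nbij' (fun x => rConfig S x) (fun x => extend S x) ?_ ?_ ?_ ?_ ?_
  · intro x _; exact Finset.mem_univ _
  · intro x _
    rw [Finset.mem_filter]
    exact ⟨Finset.mem_univ _, fun e he => extend_of_not_mem x he⟩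
  · intro x hx
    rw [Finset.mem_filter] at hx
    exact extend_rConfig hx.2
  · intro x _; exact rConfig_extend S x
  · intro x hx
    rw [Finset.mem_filter] at hx
    rw [extend_rConfig hx.2]

/-- **The typed count of the crux kernel is that of the instance restricted to any set `S`
containing the typed edges, when every edge off `S` is pinned closed.** -/
theorem typedCount_restrict (S : Finset E) (ends : E → Sym2 V) (o a₁ a₂ a₃ b : V) {F : Finset E}
    (hFS : F ⊆ S) {z : Config E} (hz : ∀ e, e ∉ S → z e = false) (τ : E → ℕ) :
    typedCount F z τ (K3 ends o a₁ a₂ a₃ b : Config E → Config E → Config E → R) =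
      typedCount (rF S F) (rConfig S z) (rτ S τ)
        (K3 (rEnds S ends) o a₁ a₂ a₃ b : Config S → Config S → Config S → R) := by
  unfold typedCount
  -- a copy open somewhere off `S` is outside the support of the count
  have hvan : ∀ x y w : Config E,
      ((∃ e, e ∉ S ∧ x e = true) ∨ (∃ e, e ∉ S ∧ y e = true) ∨ (∃ e, e ∉ S ∧ w e = true)) →
      (if (∀ e, e ∉ F → x e = z e ∧ y e = z e ∧ w e = z e) ∧
          (∀ e ∈ F, openCount x y w e = τ e) then K3 ends o a₁ a₂ a₃ b x y w else (0 : R)) = 0 := by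
    intro x y w h
    rw [if_neg]
    rintro ⟨h1, _⟩
    rcases h with ⟨e, heS, he⟩ | ⟨e, heS, he⟩ | ⟨e, heS, he⟩ <;>
    · have heF : e ∉ F := fun h => heS (hFS h)
      have := h1 e heF
      rw [hz e heS, he] at this
      simp at this
  rw [sum_config_restrict S _ fun x hx => Finset.sum_eq_zero fun y _ =>
    Finset.sum_eq_zero fun w _ => hvan x y w (Or.inl hx)]
  refine Finset.sum_congr rfl fun x _ => ?_
  rw [sum_config_restrict S _ fun y hy => Finset.sum_eq_zero fun w _ =>
    hvan _ y w (Or.inr (Or.inl hy))]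
  refine Finset.sum_congr rfl fun y _ => ?_
  rw [sum_config_restrict S _ fun w hw => hvan _ _ w (Or.inr (Or.inr hw))]
  refine Finset.sum_congr rfl fun w _ => ?_
  have hcl : ∀ u : Config S, ∀ e, e ∉ S → extend S u e = false := fun u e he =>
    extend_of_not_mem u he
  rw [K3_restrict S ends o a₁ a₂ a₃ b (hcl x) (hcl y) (hcl w), rConfig_extend, rConfig_extend,
    rConfig_extend]
  refine if_congr ?_ rfl rfl
  constructor
  · rintro ⟨h1, h2⟩
    refine ⟨fun e he => ?_, fun e he => ?_⟩
    · rw [mem_rF] at he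
      have := h1 e.1 he
      rwa [extend_of_mem x e.2, extend_of_mem y e.2, extend_of_mem w e.2] at this
    · rw [mem_rF] at he
      have := h2 e.1 he
      simpa [openCount, extend_of_mem x e.2, extend_of_mem y e.2, extend_of_mem w e.2,
        rτ] using this
  · rintro ⟨h1, h2⟩
    refine ⟨fun e he => ?_, fun e he => ?_⟩
    · by_cases heS : e ∈ S
      · have := h1 ⟨e, heS⟩ (by rw [mem_rF]; exact he)
        rwa [extend_of_mem x heS, extend_of_mem y heS, extend_of_mem w heS]
      · rw [extend_of_not_mem x heS, extend_of_not_mem y heS, extend_of_not_mem w heS, hz e heS]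
        exact ⟨rfl, rfl, rfl⟩
    · have heS : e ∈ S := hFS he
      have := h2 ⟨e, heS⟩ (by rw [mem_rF]; exact he)
      simpa [openCount, extend_of_mem x heS, extend_of_mem y heS, extend_of_mem w heS, rτ]
        using this

end Count

/-! ## The bounded spine -/

section Spine

variable {V : Type uV} [DecidableEq V] {E : Type uE} [Fintype E] [DecidableEq E]
variable {R : Type*} [Field R] [LinearOrder R] [IsStrictOrderedRing R]

/-- **THE SIZE-BOUNDED SPINE**: if row 2′TRI holds on the `ResidualR` instances with at most `N`
typed edges (over every edge type of the universe of `E`), it holds on every instance whose support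
has at most `N` edges. -/
theorem typedCount_nonneg_of_residualR_card_le (N : ℕ)
    (hNR : ∀ (E' : Type uE) [Fintype E'] [DecidableEq E'] (ends' : E' → Sym2 V) (o a₁ a₂ a₃ b : V)
      (F' : Finset E') (τ' : E' → ℕ), (∀ e ∈ F', τ' e = 1 ∨ τ' e = 2) →
      ResidualR ends' o a₁ a₂ a₃ b F' → F'.card ≤ N →
        0 ≤ typedCount F' (fun _ => false) τ'
          (K3 ends' o a₁ a₂ a₃ b : Config E' → Config E' → Config E' → R))
    (ends : E → Sym2 V) (o a₁ a₂ a₃ b : V) (F : Finset E) (z : Config E) (τ : E → ℕ)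
    (hτ : ∀ e ∈ F, τ e = 1 ∨ τ e = 2) (hN : (support F z).card ≤ N) :
    0 ≤ typedCount F z τ (K3 ends o a₁ a₂ a₃ b : Config E → Config E → Config E → R) := by
  set S := support F z with hS
  have hFS : F ⊆ S := fun e he => mem_support.2 (Or.inl he)
  have hz : ∀ e, e ∉ S → z e = false := fun e he => by
    by_contra h
    exact he (mem_support.2 (Or.inr (by simpa using h)))
  rw [typedCount_restrict S ends o a₁ a₂ a₃ b hFS hz τ]
  refine typedCount_nonneg_of_residualR (fun ends' o' a₁' a₂' a₃' b' F' τ' hτ' hR => ?_)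
    (rEnds S ends) o a₁ a₂ a₃ b (rF S F) (rConfig S z) (rτ S τ) ?_
  · refine hNR S ends' o' a₁' a₂' a₃' b' F' τ' hτ' hR ?_
    calc F'.card ≤ Fintype.card S := Finset.card_le_univ _
      _ = S.card := Fintype.card_coe S
      _ ≤ N := hN
  · intro e he
    rw [mem_rF] at he
    exact hτ e.1 he

end Spine


end Restrict

end TypedRed

end CovForm

end Summit.Ventures.PercRepro2
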